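import Literature.NumberTheory.LFunctions.FeketePolyaKernelCertificates
import Literature.NumberTheory.LFunctions.NoRealZeroOddSmallModuliII
import Literature.Barriers.RiemannHypothesis.EpsteinZetaRealZerosPairGrouping232
import Literature.Barriers.RiemannHypothesis.EpsteinZetaRealZerosPairGrouping235
import HarnessLib

/-!
# No real zero for the ODD real primitive characters of conductor `≤ 266`, in the kernel
# (`NoRealZeroOddUpTo 266`)

Topic `Literature/NumberTheory/LFunctions`; namespace `Literature.NumberTheory.LFunctions`
(private per-modulus lemmas in `….OddSmallModuliIII`). THEOREMS only (no definition, no named fact, no `sorry`).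

The odd kernel base `231` (`noRealZeroOddUpTo_231`, `NoRealZeroOddSmallModuliII.lean`) is pushed to `266`:
**`noRealZeroOddUpTo_266 : NoRealZeroOddUpTo 266`**. Per modulus `231 < q ≤ 266`: moduli without a
primitive quadratic character are dismissed (`q ≡ 2 (mod 4)`, `16 ∣ q`, `p² ∣ q` — MV Thm 9.13); the even
primitive quadratic character is excluded by the parity test of `OddSmallModuliII.good_odd_of_*`; the odd
one `χ_{−q}` is certified by the ORDER-TWO Fekete–Pólya criterion along an induced character `χ↑(q·w)`
(engine `FeketePolyaKernelCertificates.lean` of the cell seat sweep-4: `runOK`, kernel `decide`), with the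
multiplier `w` found by an integer scan (this seat, 2026-08-27); the class-number-two discriminants
`232`, `235` — which admit no Fekete–Pólya certificate of small order (Heilbronn's phenomenon) — come from
LOW'S GROUPING of the two Epstein zeta functions of the class group
(`Literature/Barriers/RiemannHypothesis/EpsteinZetaRealZerosPairGrouping*.lean`, this seat).

## References

* H. L. Montgomery, R. C. Vaughan, *Multiplicative Number Theory I*, CUP 2007, §9.3 Thm 9.13, §11.2.1
  Exercises 7–8. [MontgomeryVaughan2007]
* M. E. Low, *Real zeros of the Dedekind zeta function of an imaginary quadratic field*, Acta Arith. 14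
  (1968) 117–140. [Low1968]
* M. Watkins, *Real zeros of real odd Dirichlet L-functions*, Math. Comp. 73 (2004) 415–423.
  [Watkins2004RealZeros]
-/

namespace Literature.NumberTheory.LFunctions

namespace OddSmallModuliIII

open FeketePolyaKernel PrimitiveQuadratic OddSmallModuliII
open Literature.Barriers.RiemannHypothesis

/-- Conductor `≡ 2 (mod 4)`: no primitive character (private copy of the sweep-4 lemma).
[cite: MontgomeryVaughan2007, §9.3 Theorem 9.13] -/
private theorem absurd_of_mod_four_two {q : ℕ} [NeZero q] (hq : q % 4 = 2)
    {χ : DirichletCharacter ℂ q} (hprim : χ.IsPrimitive) : False := by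
  obtain ⟨m, rfl⟩ : ∃ m, q = 2 * m := ⟨q / 2, by omega⟩
  haveI : NeZero m := ⟨by omega⟩
  exact not_isPrimitive_two_mul (m := m) (Nat.odd_iff.mpr (by omega)) hprim

/-- Conductor divisible by `16`: no primitive quadratic character (private copy).
[cite: MontgomeryVaughan2007, §9.3 Theorem 9.13] -/
private theorem absurd_of_sixteen_dvd {q : ℕ} [NeZero q] (hq : q % 16 = 0) {χ : DirichletCharacter ℂ q}
    (hprim : χ.IsPrimitive) (hquad : χ.IsQuadratic) : False := by
  obtain ⟨k, m, hm, rfl⟩ := Nat.exists_eq_two_pow_mul_odd (NeZero.ne q)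
  have hm2 := Nat.odd_iff.mp hm
  haveI : NeZero m := ⟨by omega⟩
  have hk := le_three_of_level_two_pow_mul hm hprim hquad
  interval_cases k <;> norm_num at hq <;> omega

/-- Conductor with an odd square factor `p²`: no primitive quadratic character (private copy).
[cite: MontgomeryVaughan2007, §9.3 Theorem 9.13] -/
private theorem absurd_of_sq_dvd {q : ℕ} [NeZero q] {p : ℕ} (hp : p.Prime) (hp2 : p ≠ 2)
    (hpq : p * p ∣ q) {χ : DirichletCharacter ℂ q} (hprim : χ.IsPrimitive) (hquad : χ.IsQuadratic) :
    False := by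
  obtain ⟨k, m, hm, rfl⟩ := Nat.exists_eq_two_pow_mul_odd (NeZero.ne q)
  have hm2 := Nat.odd_iff.mp hm
  haveI : NeZero m := ⟨by omega⟩
  have hsq := squarefree_of_level_two_pow_mul hm hprim hquad
  have hp2' : Nat.Coprime p 2 := (Nat.coprime_primes hp Nat.prime_two).mpr hp2
  have hcop : Nat.Coprime (p * p) (2 ^ k) := Nat.Coprime.pow_right k (Nat.Coprime.mul_left hp2' hp2')
  have hpm : p * p ∣ m := hcop.dvd_of_dvd_mul_left hpq
  exact hp.one_lt.ne' (Nat.isUnit_iff.mp (hsq p hpm))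

/-- Modulus `232`: `h(−232) = 2`, classes `(1,0,58)`, `(2,0,29)`, NO Fekete–Pólya certificate of order `≤ 24` and modulus `≤ 3·10⁶`:
Low's grouping of the two Epstein zeta functions (`EpsteinZetaRealZerosPairGrouping232.lean`). [cite: Low1968, Theorem 5 (via MR 38#4425)] -/
private theorem goodOdd232 :
    ∀ χ : DirichletCharacter ℂ 232, χ.IsQuadratic → χ.IsPrimitive → χ.Odd →
      ∀ σ : ℝ, 0 < σ → σ < 1 → χ.LFunction σ ≠ 0 :=
  fun _ hquad hprim hodd _ hσ0 hσ1 ↦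
    LFunction_ne_zero_of_odd_quadratic_232 hprim hquad hodd hσ0 hσ1

/-- Modulus `233`: `233 ≡ 1 (mod 4)`: the primitive quadratic character `(·/233)` is even (parity test). [cite: MontgomeryVaughan2007, §11.2.1 Exercises 7 (g), 8] -/
private theorem goodOdd233 :
    ∀ χ : DirichletCharacter ℂ 233, χ.IsQuadratic → χ.IsPrimitive → χ.Odd →
      ∀ σ : ℝ, 0 < σ → σ < 1 → χ.LFunction σ ≠ 0 :=
  good_odd_of_odd (by decide) (by decide) 1 (by decide) (by decide +kernel)

/-- Modulus `234`: `234 ≡ 2 (mod 4)`: no primitive character. [cite: MontgomeryVaughan2007, §9.3 Theorem 9.13] -/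
private theorem goodOdd234 :
    ∀ χ : DirichletCharacter ℂ 234, χ.IsQuadratic → χ.IsPrimitive → χ.Odd →
      ∀ σ : ℝ, 0 < σ → σ < 1 → χ.LFunction σ ≠ 0 :=
  fun χ hquad hprim _ ↦ (absurd_of_mod_four_two (by decide) hprim).elim

/-- Modulus `235`: `h(−235) = 2`, classes `(1,1,59)`, `(5,5,13)` (a Fekete–Pólya certificate exists only at order `9`,
modulus `54 285`): Low's grouping of the two Epstein zeta functions (`EpsteinZetaRealZerosPairGrouping235.lean`). [cite: Low1968, Theorem 5 (via MR 38#4425)] -/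
private theorem goodOdd235 :
    ∀ χ : DirichletCharacter ℂ 235, χ.IsQuadratic → χ.IsPrimitive → χ.Odd →
      ∀ σ : ℝ, 0 < σ → σ < 1 → χ.LFunction σ ≠ 0 :=
  fun _ hquad hprim hodd _ hσ0 hσ1 ↦
    LFunction_ne_zero_of_odd_quadratic_235 hprim hquad hodd hσ0 hσ1

/-- Modulus `236`: `236 = 4·59`, `59 ≡ 3 (mod 4)`: the primitive quadratic character is even (parity test). [cite: MontgomeryVaughan2007, §11.2.1 Exercises 7 (g), 8] -/
private theorem goodOdd236 :
    ∀ χ : DirichletCharacter ℂ 236, χ.IsQuadratic → χ.IsPrimitive → χ.Odd →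
      ∀ σ : ℝ, 0 < σ → σ < 1 → χ.LFunction σ ≠ 0 :=
  good_odd_of_four (by decide) (by decide) 1 (by decide) (by decide +kernel)

/-- Modulus `237`: `237 ≡ 1 (mod 4)`: the primitive quadratic character `(·/237)` is even (parity test). [cite: MontgomeryVaughan2007, §11.2.1 Exercises 7 (g), 8] -/
private theorem goodOdd237 :
    ∀ χ : DirichletCharacter ℂ 237, χ.IsQuadratic → χ.IsPrimitive → χ.Odd →
      ∀ σ : ℝ, 0 < σ → σ < 1 → χ.LFunction σ ≠ 0 :=
  good_odd_of_odd (by decide) (by decide) 1 (by decide) (by decide +kernel)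

/-- Modulus `238`: `238 ≡ 2 (mod 4)`: no primitive character. [cite: MontgomeryVaughan2007, §9.3 Theorem 9.13] -/
private theorem goodOdd238 :
    ∀ χ : DirichletCharacter ℂ 238, χ.IsQuadratic → χ.IsPrimitive → χ.Odd →
      ∀ σ : ℝ, 0 < σ → σ < 1 → χ.LFunction σ ≠ 0 :=
  fun χ hquad hprim _ ↦ (absurd_of_mod_four_two (by decide) hprim).elim

/-- Modulus `239`: `χ_{−239}`: order-two Fekete–Pólya certificate along the induced character mod `239`. [cite: MontgomeryVaughan2007, §11.2.1 Exercises 7 (g), 8] -/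
private theorem goodOdd239 :
    ∀ χ : DirichletCharacter ℂ 239, χ.IsQuadratic → χ.IsPrimitive → χ.Odd →
      ∀ σ : ℝ, 0 < σ → σ < 1 → χ.LFunction σ ≠ 0 :=
  good_odd_of_odd (by decide) (by decide) 1 (by decide) (by decide +kernel)

/-- Modulus `240`: `16 ∣ 240`: no primitive quadratic character. [cite: MontgomeryVaughan2007, §9.3 Theorem 9.13] -/
private theorem goodOdd240 :
    ∀ χ : DirichletCharacter ℂ 240, χ.IsQuadratic → χ.IsPrimitive → χ.Odd →
      ∀ σ : ℝ, 0 < σ → σ < 1 → χ.LFunction σ ≠ 0 :=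
  fun χ hquad hprim _ ↦ (absurd_of_sixteen_dvd (by decide) hprim hquad).elim

/-- Modulus `241`: `241 ≡ 1 (mod 4)`: the primitive quadratic character `(·/241)` is even (parity test). [cite: MontgomeryVaughan2007, §11.2.1 Exercises 7 (g), 8] -/
private theorem goodOdd241 :
    ∀ χ : DirichletCharacter ℂ 241, χ.IsQuadratic → χ.IsPrimitive → χ.Odd →
      ∀ σ : ℝ, 0 < σ → σ < 1 → χ.LFunction σ ≠ 0 :=
  good_odd_of_odd (by decide) (by decide) 1 (by decide) (by decide +kernel)

/-- Modulus `242`: `242 ≡ 2 (mod 4)`: no primitive character. [cite: MontgomeryVaughan2007, §9.3 Theorem 9.13] -/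
private theorem goodOdd242 :
    ∀ χ : DirichletCharacter ℂ 242, χ.IsQuadratic → χ.IsPrimitive → χ.Odd →
      ∀ σ : ℝ, 0 < σ → σ < 1 → χ.LFunction σ ≠ 0 :=
  fun χ hquad hprim _ ↦ (absurd_of_mod_four_two (by decide) hprim).elim

/-- Modulus `243`: `3² ∣ 243`: no primitive quadratic character. [cite: MontgomeryVaughan2007, §9.3 Theorem 9.13] -/
private theorem goodOdd243 :
    ∀ χ : DirichletCharacter ℂ 243, χ.IsQuadratic → χ.IsPrimitive → χ.Odd →
      ∀ σ : ℝ, 0 < σ → σ < 1 → χ.LFunction σ ≠ 0 :=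
  fun χ hquad hprim _ ↦
    (absurd_of_sq_dvd (p := 3) (by norm_num) (by decide) (by decide) hprim hquad).elim

/-- Modulus `244`: `χ_{−244}` (`244 = 4·61`): order-two certificate along the induced character mod `244`. [cite: MontgomeryVaughan2007, §11.2.1 Exercises 7 (g), 8] -/
private theorem goodOdd244 :
    ∀ χ : DirichletCharacter ℂ 244, χ.IsQuadratic → χ.IsPrimitive → χ.Odd →
      ∀ σ : ℝ, 0 < σ → σ < 1 → χ.LFunction σ ≠ 0 :=
  good_odd_of_four (by decide) (by decide) 1 (by decide) (by decide +kernel)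

/-- Modulus `245`: `7² ∣ 245`: no primitive quadratic character. [cite: MontgomeryVaughan2007, §9.3 Theorem 9.13] -/
private theorem goodOdd245 :
    ∀ χ : DirichletCharacter ℂ 245, χ.IsQuadratic → χ.IsPrimitive → χ.Odd →
      ∀ σ : ℝ, 0 < σ → σ < 1 → χ.LFunction σ ≠ 0 :=
  fun χ hquad hprim _ ↦
    (absurd_of_sq_dvd (p := 7) (by norm_num) (by decide) (by decide) hprim hquad).elim

/-- Modulus `246`: `246 ≡ 2 (mod 4)`: no primitive character. [cite: MontgomeryVaughan2007, §9.3 Theorem 9.13] -/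
private theorem goodOdd246 :
    ∀ χ : DirichletCharacter ℂ 246, χ.IsQuadratic → χ.IsPrimitive → χ.Odd →
      ∀ σ : ℝ, 0 < σ → σ < 1 → χ.LFunction σ ≠ 0 :=
  fun χ hquad hprim _ ↦ (absurd_of_mod_four_two (by decide) hprim).elim

/-- Modulus `247`: `χ_{−247}`: order-two Fekete–Pólya certificate along the induced character mod `741` (`= 247·3`). [cite: MontgomeryVaughan2007, §11.2.1 Exercises 7 (g), 8] -/
private theorem goodOdd247 :
    ∀ χ : DirichletCharacter ℂ 247, χ.IsQuadratic → χ.IsPrimitive → χ.Odd →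
      ∀ σ : ℝ, 0 < σ → σ < 1 → χ.LFunction σ ≠ 0 :=
  good_odd_of_odd (by decide) (by decide) 3 (by decide) (by decide +kernel)

/-- Modulus `248`: `248 = 8·31`: the odd one of the two primitive quadratic characters by an order-two certificate mod `248`, the even one by the parity test. [cite: MontgomeryVaughan2007, §11.2.1 Exercises 7 (g), 8] -/
private theorem goodOdd248 :
    ∀ χ : DirichletCharacter ℂ 248, χ.IsQuadratic → χ.IsPrimitive → χ.Odd →
      ∀ σ : ℝ, 0 < σ → σ < 1 → χ.LFunction σ ≠ 0 :=
  good_odd_of_eight (by decide) (by decide) 1 (by decide) (by decide +kernel) (by decide +kernel)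

/-- Modulus `249`: `249 ≡ 1 (mod 4)`: the primitive quadratic character `(·/249)` is even (parity test). [cite: MontgomeryVaughan2007, §11.2.1 Exercises 7 (g), 8] -/
private theorem goodOdd249 :
    ∀ χ : DirichletCharacter ℂ 249, χ.IsQuadratic → χ.IsPrimitive → χ.Odd →
      ∀ σ : ℝ, 0 < σ → σ < 1 → χ.LFunction σ ≠ 0 :=
  good_odd_of_odd (by decide) (by decide) 1 (by decide) (by decide +kernel)

/-- Modulus `250`: `250 ≡ 2 (mod 4)`: no primitive character. [cite: MontgomeryVaughan2007, §9.3 Theorem 9.13] -/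
private theorem goodOdd250 :
    ∀ χ : DirichletCharacter ℂ 250, χ.IsQuadratic → χ.IsPrimitive → χ.Odd →
      ∀ σ : ℝ, 0 < σ → σ < 1 → χ.LFunction σ ≠ 0 :=
  fun χ hquad hprim _ ↦ (absurd_of_mod_four_two (by decide) hprim).elim

/-- Modulus `251`: `χ_{−251}`: order-two Fekete–Pólya certificate along the induced character mod `251`. [cite: MontgomeryVaughan2007, §11.2.1 Exercises 7 (g), 8] -/
private theorem goodOdd251 :
    ∀ χ : DirichletCharacter ℂ 251, χ.IsQuadratic → χ.IsPrimitive → χ.Odd →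
      ∀ σ : ℝ, 0 < σ → σ < 1 → χ.LFunction σ ≠ 0 :=
  good_odd_of_odd (by decide) (by decide) 1 (by decide) (by decide +kernel)

/-- Modulus `252`: `3² ∣ 252`: no primitive quadratic character. [cite: MontgomeryVaughan2007, §9.3 Theorem 9.13] -/
private theorem goodOdd252 :
    ∀ χ : DirichletCharacter ℂ 252, χ.IsQuadratic → χ.IsPrimitive → χ.Odd →
      ∀ σ : ℝ, 0 < σ → σ < 1 → χ.LFunction σ ≠ 0 :=
  fun χ hquad hprim _ ↦
    (absurd_of_sq_dvd (p := 3) (by norm_num) (by decide) (by decide) hprim hquad).elim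

/-- Modulus `253`: `253 ≡ 1 (mod 4)`: the primitive quadratic character `(·/253)` is even (parity test). [cite: MontgomeryVaughan2007, §11.2.1 Exercises 7 (g), 8] -/
private theorem goodOdd253 :
    ∀ χ : DirichletCharacter ℂ 253, χ.IsQuadratic → χ.IsPrimitive → χ.Odd →
      ∀ σ : ℝ, 0 < σ → σ < 1 → χ.LFunction σ ≠ 0 :=
  good_odd_of_odd (by decide) (by decide) 1 (by decide) (by decide +kernel)

/-- Modulus `254`: `254 ≡ 2 (mod 4)`: no primitive character. [cite: MontgomeryVaughan2007, §9.3 Theorem 9.13] -/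
private theorem goodOdd254 :
    ∀ χ : DirichletCharacter ℂ 254, χ.IsQuadratic → χ.IsPrimitive → χ.Odd →
      ∀ σ : ℝ, 0 < σ → σ < 1 → χ.LFunction σ ≠ 0 :=
  fun χ hquad hprim _ ↦ (absurd_of_mod_four_two (by decide) hprim).elim

/-- Modulus `255`: `χ_{−255}`: order-two Fekete–Pólya certificate along the induced character mod `255`. [cite: MontgomeryVaughan2007, §11.2.1 Exercises 7 (g), 8] -/
private theorem goodOdd255 :
    ∀ χ : DirichletCharacter ℂ 255, χ.IsQuadratic → χ.IsPrimitive → χ.Odd →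
      ∀ σ : ℝ, 0 < σ → σ < 1 → χ.LFunction σ ≠ 0 :=
  good_odd_of_odd (by decide) (by decide) 1 (by decide) (by decide +kernel)

/-- Modulus `256`: `16 ∣ 256`: no primitive quadratic character. [cite: MontgomeryVaughan2007, §9.3 Theorem 9.13] -/
private theorem goodOdd256 :
    ∀ χ : DirichletCharacter ℂ 256, χ.IsQuadratic → χ.IsPrimitive → χ.Odd →
      ∀ σ : ℝ, 0 < σ → σ < 1 → χ.LFunction σ ≠ 0 :=
  fun χ hquad hprim _ ↦ (absurd_of_sixteen_dvd (by decide) hprim hquad).elim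

/-- Modulus `257`: `257 ≡ 1 (mod 4)`: the primitive quadratic character `(·/257)` is even (parity test). [cite: MontgomeryVaughan2007, §11.2.1 Exercises 7 (g), 8] -/
private theorem goodOdd257 :
    ∀ χ : DirichletCharacter ℂ 257, χ.IsQuadratic → χ.IsPrimitive → χ.Odd →
      ∀ σ : ℝ, 0 < σ → σ < 1 → χ.LFunction σ ≠ 0 :=
  good_odd_of_odd (by decide) (by decide) 1 (by decide) (by decide +kernel)

/-- Modulus `258`: `258 ≡ 2 (mod 4)`: no primitive character. [cite: MontgomeryVaughan2007, §9.3 Theorem 9.13] -/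
private theorem goodOdd258 :
    ∀ χ : DirichletCharacter ℂ 258, χ.IsQuadratic → χ.IsPrimitive → χ.Odd →
      ∀ σ : ℝ, 0 < σ → σ < 1 → χ.LFunction σ ≠ 0 :=
  fun χ hquad hprim _ ↦ (absurd_of_mod_four_two (by decide) hprim).elim

/-- Modulus `259`: `χ_{−259}`: order-two Fekete–Pólya certificate along the induced character mod `259`. [cite: MontgomeryVaughan2007, §11.2.1 Exercises 7 (g), 8] -/
private theorem goodOdd259 :
    ∀ χ : DirichletCharacter ℂ 259, χ.IsQuadratic → χ.IsPrimitive → χ.Odd →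
      ∀ σ : ℝ, 0 < σ → σ < 1 → χ.LFunction σ ≠ 0 :=
  good_odd_of_odd (by decide) (by decide) 1 (by decide) (by decide +kernel)

/-- Modulus `260`: `χ_{−260}` (`260 = 4·65`): order-two certificate along the induced character mod `260`. [cite: MontgomeryVaughan2007, §11.2.1 Exercises 7 (g), 8] -/
private theorem goodOdd260 :
    ∀ χ : DirichletCharacter ℂ 260, χ.IsQuadratic → χ.IsPrimitive → χ.Odd →
      ∀ σ : ℝ, 0 < σ → σ < 1 → χ.LFunction σ ≠ 0 :=
  good_odd_of_four (by decide) (by decide) 1 (by decide) (by decide +kernel)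

/-- Modulus `261`: `3² ∣ 261`: no primitive quadratic character. [cite: MontgomeryVaughan2007, §9.3 Theorem 9.13] -/
private theorem goodOdd261 :
    ∀ χ : DirichletCharacter ℂ 261, χ.IsQuadratic → χ.IsPrimitive → χ.Odd →
      ∀ σ : ℝ, 0 < σ → σ < 1 → χ.LFunction σ ≠ 0 :=
  fun χ hquad hprim _ ↦
    (absurd_of_sq_dvd (p := 3) (by norm_num) (by decide) (by decide) hprim hquad).elim

/-- Modulus `262`: `262 ≡ 2 (mod 4)`: no primitive character. [cite: MontgomeryVaughan2007, §9.3 Theorem 9.13] -/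
private theorem goodOdd262 :
    ∀ χ : DirichletCharacter ℂ 262, χ.IsQuadratic → χ.IsPrimitive → χ.Odd →
      ∀ σ : ℝ, 0 < σ → σ < 1 → χ.LFunction σ ≠ 0 :=
  fun χ hquad hprim _ ↦ (absurd_of_mod_four_two (by decide) hprim).elim

/-- Modulus `263`: `χ_{−263}`: order-two Fekete–Pólya certificate along the induced character mod `263`. [cite: MontgomeryVaughan2007, §11.2.1 Exercises 7 (g), 8] -/
private theorem goodOdd263 :
    ∀ χ : DirichletCharacter ℂ 263, χ.IsQuadratic → χ.IsPrimitive → χ.Odd →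
      ∀ σ : ℝ, 0 < σ → σ < 1 → χ.LFunction σ ≠ 0 :=
  good_odd_of_odd (by decide) (by decide) 1 (by decide) (by decide +kernel)

/-- Modulus `264`: `264 = 8·33`: the odd one of the two primitive quadratic characters by an order-two certificate mod `264`, the even one by the parity test. [cite: MontgomeryVaughan2007, §11.2.1 Exercises 7 (g), 8] -/
private theorem goodOdd264 :
    ∀ χ : DirichletCharacter ℂ 264, χ.IsQuadratic → χ.IsPrimitive → χ.Odd →
      ∀ σ : ℝ, 0 < σ → σ < 1 → χ.LFunction σ ≠ 0 :=
  good_odd_of_eight (by decide) (by decide) 1 (by decide) (by decide +kernel) (by decide +kernel)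

/-- Modulus `265`: `265 ≡ 1 (mod 4)`: the primitive quadratic character `(·/265)` is even (parity test). [cite: MontgomeryVaughan2007, §11.2.1 Exercises 7 (g), 8] -/
private theorem goodOdd265 :
    ∀ χ : DirichletCharacter ℂ 265, χ.IsQuadratic → χ.IsPrimitive → χ.Odd →
      ∀ σ : ℝ, 0 < σ → σ < 1 → χ.LFunction σ ≠ 0 :=
  good_odd_of_odd (by decide) (by decide) 1 (by decide) (by decide +kernel)

/-- Modulus `266`: `266 ≡ 2 (mod 4)`: no primitive character. [cite: MontgomeryVaughan2007, §9.3 Theorem 9.13] -/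
private theorem goodOdd266 :
    ∀ χ : DirichletCharacter ℂ 266, χ.IsQuadratic → χ.IsPrimitive → χ.Odd →
      ∀ σ : ℝ, 0 < σ → σ < 1 → χ.LFunction σ ≠ 0 :=
  fun χ hquad hprim _ ↦ (absurd_of_mod_four_two (by decide) hprim).elim

end OddSmallModuliIII

open OddSmallModuliIII in
/-- **No real zero in `(0, 1)` for every odd real primitive character of conductor `231 < q ≤ 266`**
(per-modulus kernel computations of this file). [cite: MontgomeryVaughan2007, §11.2.1 Exercises 7 (g), 8] -/
theorem noRealZeroOdd_range_232_266 : ∀ (q : ℕ) [NeZero q], 231 < q → q ≤ 266 →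
    ∀ χ : DirichletCharacter ℂ q, χ.IsQuadratic → χ.IsPrimitive → χ.Odd →
      ∀ σ : ℝ, 0 < σ → σ < 1 → χ.LFunction σ ≠ 0 := by
  intro q _ hlo hhi χ hquad hprim hodd σ hσ0 hσ1
  interval_cases q
  · exact goodOdd232 χ hquad hprim hodd σ hσ0 hσ1
  · exact goodOdd233 χ hquad hprim hodd σ hσ0 hσ1
  · exact goodOdd234 χ hquad hprim hodd σ hσ0 hσ1
  · exact goodOdd235 χ hquad hprim hodd σ hσ0 hσ1
  · exact goodOdd236 χ hquad hprim hodd σ hσ0 hσ1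
  · exact goodOdd237 χ hquad hprim hodd σ hσ0 hσ1
  · exact goodOdd238 χ hquad hprim hodd σ hσ0 hσ1
  · exact goodOdd239 χ hquad hprim hodd σ hσ0 hσ1
  · exact goodOdd240 χ hquad hprim hodd σ hσ0 hσ1
  · exact goodOdd241 χ hquad hprim hodd σ hσ0 hσ1
  · exact goodOdd242 χ hquad hprim hodd σ hσ0 hσ1
  · exact goodOdd243 χ hquad hprim hodd σ hσ0 hσ1
  · exact goodOdd244 χ hquad hprim hodd σ hσ0 hσ1
  · exact goodOdd245 χ hquad hprim hodd σ hσ0 hσ1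
  · exact goodOdd246 χ hquad hprim hodd σ hσ0 hσ1
  · exact goodOdd247 χ hquad hprim hodd σ hσ0 hσ1
  · exact goodOdd248 χ hquad hprim hodd σ hσ0 hσ1
  · exact goodOdd249 χ hquad hprim hodd σ hσ0 hσ1
  · exact goodOdd250 χ hquad hprim hodd σ hσ0 hσ1
  · exact goodOdd251 χ hquad hprim hodd σ hσ0 hσ1
  · exact goodOdd252 χ hquad hprim hodd σ hσ0 hσ1
  · exact goodOdd253 χ hquad hprim hodd σ hσ0 hσ1
  · exact goodOdd254 χ hquad hprim hodd σ hσ0 hσ1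
  · exact goodOdd255 χ hquad hprim hodd σ hσ0 hσ1
  · exact goodOdd256 χ hquad hprim hodd σ hσ0 hσ1
  · exact goodOdd257 χ hquad hprim hodd σ hσ0 hσ1
  · exact goodOdd258 χ hquad hprim hodd σ hσ0 hσ1
  · exact goodOdd259 χ hquad hprim hodd σ hσ0 hσ1
  · exact goodOdd260 χ hquad hprim hodd σ hσ0 hσ1
  · exact goodOdd261 χ hquad hprim hodd σ hσ0 hσ1
  · exact goodOdd262 χ hquad hprim hodd σ hσ0 hσ1
  · exact goodOdd263 χ hquad hprim hodd σ hσ0 hσ1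
  · exact goodOdd264 χ hquad hprim hodd σ hσ0 hσ1
  · exact goodOdd265 χ hquad hprim hodd σ hσ0 hσ1
  · exact goodOdd266 χ hquad hprim hodd σ hσ0 hσ1

/-- **`NoRealZeroOddUpTo 266`, unconditionally**: no odd real primitive character of conductor `≤ 266`
has a real zero in `(0, 1)` (`q ≤ 231`: `noRealZeroOddUpTo_231`; `231 < q ≤ 266`: this file).
[cite: Low1968, Theorem 5 (via MR 38#4425)] [cite: MontgomeryVaughan2007, §11.2.1 Exercises 7 (g), 8] -/
theorem noRealZeroOddUpTo_266 : NoRealZeroOddUpTo 266 := by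
  intro q _ hq3 hq χ hquad hprim hodd σ hσ0 hσ1
  by_cases h : q ≤ 231
  · exact noRealZeroOddUpTo_231 q hq3 h χ hquad hprim hodd σ hσ0 hσ1
  · exact noRealZeroOdd_range_232_266 q (by omega) hq χ hquad hprim hodd σ hσ0 hσ1

end Literature.NumberTheory.LFunctions
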